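import Summits.ResolutionOfSingularities.ResolutionOfSingularities.Theorems.WeightedInvariantE2ReadingGeneric
import HarnessLib

/-!
# E2 centre, word (G-6b) `e2CentreHom`: `E2CentreHomBody` (hence `stub_e2_centre_h`) from the LAST input «(a″)» — `Rₙ(W)` has NO EMBEDDED
# associated points (every associated point is maximal in `closure (maxLocus₂)` and generises a read point)

Route `ResolutionOfSingularities/WeightedInvariant`, crux `Theses.WeightedInvariant.HypersurfaceCentreConstruction`
(stmt-ResolutionOfSingularities-19897), door line `local-engine` (skeleton v3.12), E2 tier, registered stub `stub_e2_centre_h`, word (G-6b)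
(`…ELadderTwoCentreOfHom`), proof route «LEMMA H» (`Cruxes/HypersurfaceCentreConstruction/G6B-LEMMA-H.md`).  …E2CentreHomOfAss reduced (G-6b) to
«(a′)» (associated points maximal in `closure (maxLocus₂)`, of dimension `≤ 3`, read by `J`); …E2ReadingGeneric discharges the dimension and reading
conjuncts at every point of `supp Rₙ` generising a read point.  Hence (G-6b) — and the registered stub BY ITS STATEMENT — follow from

«(a″)» for every stage `S` ((I0)₂, `X` not regular), every stalkwise-maximal canonical e = 2 centre `R`, every affine open `W` and `n`: each associated
prime of `Γ(S.Y, W) ⧸ Rₙ(W)` is `𝔭_W(ξ)` for a point `ξ ∈ W` MAXIMAL in `closure (maxLocus₂)` under generisation which generises some point of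
`maxLocus₂` — i.e. `Rₙ(W)` has no embedded associated primes (memo step 1; to be derived from the stalkwise maximality of `R`; the second conjunct is
automatic for the generic point of an irreducible component of `closure (maxLocus₂)`).

Here `ξ ∈ supp Rₙ ⊆ closure (maxLocus₂)` comes for free (`Rₙ(W) ≤ 𝔮` for an associated prime `𝔮`; `IsCanonicalCentre₂.stalkIdeal_eq_top`).  Results:
`e2CentreHomBody_of_noEmbedded`, `e2CentreHom_of_noEmbedded` (registrar shape), `stub_e2_centre_h_of_noEmbedded`.  Def-free helper
(`--supports stmt-ResolutionOfSingularities-19897`); nothing here asserts any clause or anything about resolution of singularities in characteristic `p`;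
AI-written, weaker than expert review. [OURS · L1 W4.3]
-/

noncomputable section

set_option linter.dupNamespace false -- mandated namespace of this single-conjunct summit

open CategoryTheory AlgebraicGeometry TopologicalSpace IsLocalRing Topology
open Literature.AlgebraicGeometry.Resolution
open Summit.ResolutionOfSingularities.ResolutionOfSingularities.Theorems
open Summit.ResolutionOfSingularities.ResolutionOfSingularities.Theorems.ELadderOne

namespace Summit.ResolutionOfSingularities.ResolutionOfSingularities.Cruxes.HypersurfaceCentreConstruction.LocalEngine

/-- An associated prime of `A ⧸ I` contains `I`. [folklore] -/
theorem le_of_mem_associatedPrimes_quotient {A : Type*} [CommRing A] [IsNoetherianRing A] {I 𝔮 : Ideal A}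
    (h𝔮 : 𝔮 ∈ associatedPrimes A (A ⧸ I)) : I ≤ 𝔮 := by
  obtain ⟨-, z, hz⟩ := (isAssociatedPrime_iff.mp h𝔮)
  intro a ha
  rw [hz, Submodule.mem_colon_singleton, Submodule.mem_bot]
  obtain ⟨z, rfl⟩ := Ideal.Quotient.mk_surjective z
  rw [Algebra.smul_def, Ideal.Quotient.algebraMap_eq, ← map_mul, Ideal.Quotient.eq_zero_iff_mem]
  exact I.mul_mem_right _ ha

/-- **`E2CentreHomBody p ι J` FROM «(a″)»** (no embedded associated points), under the graded HOM rung. [folklore] -/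
theorem e2CentreHomBody_of_noEmbedded (p : ℕ) (ι : (R : Type) → [CommRing R] → R → Ordinal.{0})
    (J : (R : Type) → [CommRing R] → R → ℕ → Ideal R) (hr : PRungGrHomLE 3 p ι J)
    (hass : ∀ ⦃k : Type⦄ [Field k] [CharP k p] [PerfectField k] (S : Stage k), S.InvDim₂ → ¬ Scheme.IsRegular S.X →
      ∀ (R : ReesAlgebraData S.Y), S.IsCanonicalCentre₂ ι J R →
      (∀ (n : ℕ) (K : S.Y.IdealSheafData),
        (∀ η ∈ S.maxLocus₂ ι, stalkIdeal K η ≤ J (S.Y.presheaf.stalk η) (localGenerator S.i.ker η) n) → K ≤ R.piece n) →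
      ∀ (W : S.Y.affineOpens) (n : ℕ), ∀ 𝔮 ∈ associatedPrimes Γ(S.Y, W) (Γ(S.Y, W) ⧸ (R.piece n).ideal W),
        ∃ (ξ : S.Y) (hξW : ξ ∈ (W : S.Y.Opens)), (W.2.primeIdealOf ⟨ξ, hξW⟩).asIdeal = 𝔮 ∧
          (∀ y' ∈ closure (S.maxLocus₂ ι), y' ⤳ ξ → ξ ⤳ y') ∧ ∃ η ∈ S.maxLocus₂ ι, ξ ⤳ η) :
    E2CentreHomBody p ι J := by
  refine e2CentreHomBody_of_assMaximal p ι J hr ?_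
  intro k _ _ _ S h0 hXreg R hR hmaxR W n 𝔮 h𝔮
  obtain ⟨ξ, hξW, hξ𝔮, hmax, η, hη, hξη⟩ := hass S h0 hXreg R hR hmaxR W n 𝔮 h𝔮
  haveI : IsLocallyNoetherian S.Y := LocallyOfFiniteType.isLocallyNoetherian S.f
  haveI : IsNoetherianRing Γ(S.Y, W) := IsLocallyNoetherian.component_noetherian W
  have hI𝔮 : (R.piece n).ideal W ≤ 𝔮 := le_of_mem_associatedPrimes_quotient h𝔮
  -- `ξ ∈ supp Rₙ ⊆ closure (maxLocus₂)`
  have hξsupp : ξ ∈ (R.piece n).support := by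
    refine (Scheme.IdealSheafData.mem_support_iff_of_mem (I := R.piece n) (U := W) hξW).mpr ?_
    refine (Scheme.mem_zeroLocus_iff S.Y _ ξ).mpr fun a ha hξa => ?_
    exact (mem_basicOpen_iff_not_mem W hξW a).mp hξa (hξ𝔮 ▸ hI𝔮 ha)
  have hξcl : ξ ∈ closure (S.maxLocus₂ ι) := by
    by_contra h
    have htop := hR.stalkIdeal_eq_top ξ h n
    have hle := (mem_support_iff_stalkIdeal_le (R.piece n) ξ).mp hξsupp
    rw [htop, top_le_iff] at hle
    exact (maximalIdeal.isMaximal (S.Y.presheaf.stalk ξ)).ne_top hle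
  exact ⟨ξ, hξW, hξ𝔮, hξcl, hmax, S.ringKrullDim_stalk_le_three_of_specializes_maxLocus₂ ι hη hξη,
    S.stalkIdeal_piece_eq_J_of_specializes ι J hr hR hη hξη hξsupp⟩

/-- **The word (G-6b) in the registrar's shape, from «(a″)».** [folklore] -/
theorem e2CentreHom_of_noEmbedded (p : ℕ) (ι : (R : Type) → [CommRing R] → R → Ordinal.{0})
    (J : (R : Type) → [CommRing R] → R → ℕ → Ideal R)
    (hass : ∀ ⦃k : Type⦄ [Field k] [CharP k p] [PerfectField k] (S : Stage k), S.InvDim₂ → ¬ Scheme.IsRegular S.X →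
      ∀ (R : ReesAlgebraData S.Y), S.IsCanonicalCentre₂ ι J R →
      (∀ (n : ℕ) (K : S.Y.IdealSheafData),
        (∀ η ∈ S.maxLocus₂ ι, stalkIdeal K η ≤ J (S.Y.presheaf.stalk η) (localGenerator S.i.ker η) n) → K ≤ R.piece n) →
      ∀ (W : S.Y.affineOpens) (n : ℕ), ∀ 𝔮 ∈ associatedPrimes Γ(S.Y, W) (Γ(S.Y, W) ⧸ (R.piece n).ideal W),
        ∃ (ξ : S.Y) (hξW : ξ ∈ (W : S.Y.Opens)), (W.2.primeIdealOf ⟨ξ, hξW⟩).asIdeal = 𝔮 ∧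
          (∀ y' ∈ closure (S.maxLocus₂ ι), y' ⤳ ξ → ξ ⤳ y') ∧ ∃ η ∈ S.maxLocus₂ ι, ξ ⤳ η) :
    PRungGrHomLE 3 p ι J → E2HomogeneousChartBody p ι J → E2CentreHomBody p ι J :=
  fun hr _ => e2CentreHomBody_of_noEmbedded p ι J hr hass

/-- **The registered stub `stub_e2_centre_h` BY ITS STATEMENT from «(a″)» alone**, via `stub_e2_centre_h_of_hom`. [folklore] -/
theorem stub_e2_centre_h_of_noEmbedded
    (hass : ∀ p : ℕ, p.Prime → ∀ (ι : (R : Type) → [CommRing R] → R → Ordinal.{0})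
      (J : (R : Type) → [CommRing R] → R → ℕ → Ideal R), PRungGrHomLE 3 p ι J →
      ∀ ⦃k : Type⦄ [Field k] [CharP k p] [PerfectField k] (S : Stage k), S.InvDim₂ → ¬ Scheme.IsRegular S.X →
      ∀ (R : ReesAlgebraData S.Y), S.IsCanonicalCentre₂ ι J R →
      (∀ (n : ℕ) (K : S.Y.IdealSheafData),
        (∀ η ∈ S.maxLocus₂ ι, stalkIdeal K η ≤ J (S.Y.presheaf.stalk η) (localGenerator S.i.ker η) n) → K ≤ R.piece n) →
      ∀ (W : S.Y.affineOpens) (n : ℕ), ∀ 𝔮 ∈ associatedPrimes Γ(S.Y, W) (Γ(S.Y, W) ⧸ (R.piece n).ideal W),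
        ∃ (ξ : S.Y) (hξW : ξ ∈ (W : S.Y.Opens)), (W.2.primeIdealOf ⟨ξ, hξW⟩).asIdeal = 𝔮 ∧
          (∀ y' ∈ closure (S.maxLocus₂ ι), y' ⤳ ξ → ξ ⤳ y') ∧ ∃ η ∈ S.maxLocus₂ ι, ξ ⤳ η) :
    ∀ p : ℕ, p.Prime → ∀ (ι : (R : Type) → [CommRing R] → R → Ordinal.{0})
      (J : (R : Type) → [CommRing R] → R → ℕ → Ideal R), E2CentreH p ι J :=
  stub_e2_centre_h_of_hom fun p hp ι J hr _ => e2CentreHomBody_of_noEmbedded p ι J hr (hass p hp ι J hr)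

end Summit.ResolutionOfSingularities.ResolutionOfSingularities.Cruxes.HypersurfaceCentreConstruction.LocalEngine

end
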